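import Literature.Topology.FourManifolds.SphereSurgeryStep
import Literature.Topology.FourManifolds.CircleMapsConjugateLoops
import Literature.AlgebraicTopology.FundamentalGroup.FiniteCover
import Literature.AlgebraicTopology.FundamentalGroup.CircleAndTorus
import Mathlib.Geometry.Manifold.Metrizable
import Mathlib.Analysis.Convex.Contractible
import Mathlib.Analysis.Normed.Module.Convex
import HarnessLib

/-!
# Killing the fundamental group by surgery on circles (Kervaire–Milnor, Thm. 5.5, first step)

Topic `Literature/Topology/FourManifolds` (fact seat of
`Literature.Topology.FourManifolds.HomotopySphere.boundsContractible_of_nullCobordism_isStablyParallelizable_four`,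
Kervaire–Milnor's Thm. 5.1 at `k = 2`).  M. Kervaire, J. Milnor, *Groups of homotopy spheres I*,
Ann. of Math. 77 (1963), proof of Thm. 5.5, p. 514: *"Choosing a suitable imbedding
`φ : S¹ × Dⁿ⁻¹ → M`, one can obtain an s-parallelizable manifold `M' = χ(M, φ)` such that `π₁M'`
is generated by fewer elements than `π₁M`.  Thus after a finite number of steps, one obtains a
manifold `M''` which is 1-connected"*, the effect of one modification on `π₁` being Lemma 5.2
(p. 513, case `p = 1 < q`): `π₁(χ(M, φ)) ≅ π₁(M)/Λ` with `Λ ∋` the class `λ` of `φ|S¹ × 0`.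

This file PROVES the `π₁`-bookkeeping of that argument and the resulting induction, in the
language of the tree (`FramedSphereFamily`, `ν.Surgered`, `NullCobordism.surgery`), leaving as the
ONLY input the differential-topological existence statement (Whitney's embedding theorem for
circles, the framing of the normal bundle, Lemma 5.4 on the choice of the framing) in the shape of
a plain hypothesis `h1` (nothing is asserted; no named fact is introduced):

* `fundamentalGroup_fg_of_compactSpace_chartedSpace_halfSpace` — **`π₁` of a compact manifold
  with boundary is finitely generated** (Hatcher 2002, proof of Thm. 1.20 with Lemma 1.15: the
  Lebesgue-number argument of `CompactManifoldFundamentalGroupFG.lean`, run with convex chart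
  balls of the half-space).
* `FramedSphereFamily.pathConnectedSpace_complement_of_pathConnectedSpace`,
  `FramedSphereFamily.pathConnectedSpace_of_surgery` — removing a framed sphere with normal fibre
  `ℝˡ⁺¹`, `l ≥ 2`, resp. the surgery along it, keeps the manifold path connected.
* `FramedSphereFamily.exists_surjective_fundamentalGroup_of_surgery_one` — **Lemma 5.2 for
  `p = 1`**: for a framed CIRCLE `φ : S¹ × ℝˡ⁺¹ ↪ X` (`l ≥ 2`) in a path-connected `X` and the
  glued space `P = jA(X ∖ S) ∪ jB(OD² × Sˡ)`, there is an epimorphism `Φ : π₁(X, x₀) ↠ π₁(P, p₀)`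
  killing the class of every loop freely homotopic to the core circle `u ↦ φ(u, 0)`
  (`π₁(X ∖ S) ≅ π₁(X)` by `SphereCoreComplementPi1`, `π₁(X ∖ S) ↠ π₁(P)` by van Kampen
  (`SphereSurgeryPi1`), and the parallel circle `u ↦ φ(u, v₀)` bounds the disc `OD² × pt` of the
  simply connected handle).
* `FramedSphereFamily.exists_generators_fundamentalGroup_surgered_one` — hence if `π₁(X, x₀)` is
  generated by a finite set `G ∋ g₀` and the core circle represents `g₀` up to free homotopy,
  `π₁(χ(X, φ))` is generated by at most `#G - 1` elements.
* `NullCobordism.exists_simplyConnectedSpace_of_circleSurgery` — **Thm. 5.5, first step, over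
  the geometric input**: let `Q` be any property of null-cobordisms of `M` (dimension `n + 1 ≥ 4`)
  such that (`h1`) for every connected `W` with `Q W` and every map `f : S¹ → W` some framed
  circle `ν` with core freely homotopic to `f` has `Q (χ(W, ν))`; then every connected `W` with
  `Q W` can be replaced by a SIMPLY CONNECTED `W₁` with `Q W₁` (and the same boundary `M`).  With
  `Q = IsStablyParallelizable` this is the hypothesis `h55`/`h_simply` of
  `ThetaFourKervaireMilnorSurgeryProofs`, `SurgeryBelowMiddleDimension`,
  `HCobordismThetaFiniteKMSurgery` reduced to the one-circle statement `h1` (Kervaire–Milnor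
  Lemmas 5.3–5.4 at `p = 1`; Kosinski 1993, X.(2.1) at `k = 1`).

Everything is proved; no definitions, no named facts.  Spaces live in `Type`.

## References

* M. Kervaire, J. Milnor, *Groups of homotopy spheres I*, Ann. of Math. 77 (1963), Lemma 5.2
  (p. 513), Thm. 5.5 and its proof (p. 514). doi:10.2307/1970128 [KervaireMilnorAnnals1963]
* J. Milnor, *A procedure for killing the homotopy groups of differentiable manifolds*, Proc.
  Sympos. Pure Math. III (1961), Lemma 2, p. 46. [MilnorKilling1961]
* A. Kosinski, *Differential Manifolds* (1993), Ch. X §2, proof of Thm. (2.2), p. 201.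
  [Kosinski1993]
* A. Hatcher, *Algebraic Topology* (2002), Lemma 1.15, Thm. 1.20, §1.1 Ex. 6. [HatcherAT2002]
-/

noncomputable section

open scoped Manifold ContDiff Topology
open Set Function Metric Topology
open Literature.AlgebraicTopology.FundamentalGroup
open Literature.AlgebraicTopology.FundamentalGroup.VanKampen

namespace Literature.Topology.FourManifolds

/-! ### `π₁` of a compact manifold with boundary is finitely generated -/

/-- **The fundamental group of a compact manifold with boundary is finitely generated**
(Hatcher 2002, proof of Thm. 1.20 with Lemma 1.15): for a compact Hausdorff space `V` charted on
the half-space `EuclideanHalfSpace (n + 1)` and every base point, `π₁(V, x₀)` is finitely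
generated.  Proof: `V` is metrizable (`Manifold.metrizableSpace`) and locally path connected;
a Lebesgue number `δ` of the cover by images of convex chart balls (simply connected); the finite
cover by path components of `δ/2`-balls satisfies the hypothesis of
`fundamentalGroup_fg_of_finite_cover`. [cite: HatcherAT2002, Lemma 1.15 and proof of Thm. 1.20] -/
theorem fundamentalGroup_fg_of_compactSpace_chartedSpace_halfSpace {n : ℕ} {V : Type*}
    [TopologicalSpace V] [T2Space V] [CompactSpace V] [ChartedSpace (EuclideanHalfSpace (n + 1)) V]
    (x₀ : V) : Group.FG (_root_.FundamentalGroup V x₀) := by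
  classical
  -- ### a metric and local path-connectedness
  letI : TopologicalSpace.MetrizableSpace V := Manifold.metrizableSpace (𝓡∂ (n + 1)) V
  letI : MetricSpace V := TopologicalSpace.metrizableSpaceMetric V
  haveI := ChartedSpace.locallyPathConnectedSpace (EuclideanHalfSpace (n + 1)) V
  -- the half-space with the metric of the ambient Euclidean space (same topology)
  letI : MetricSpace (EuclideanHalfSpace (n + 1)) := Subtype.metricSpace
  -- ### chart balls: simply connected open sets `W x ∋ x`
  have hW : ∀ x : V, ∃ W : Set V, IsOpen W ∧ x ∈ W ∧ IsSimplyConnected W := by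
    intro x
    set φ := chartAt (EuclideanHalfSpace (n + 1)) x with hφ
    obtain ⟨r, hr, hball⟩ : ∃ r > 0, ball (φ x) r ⊆ φ.target :=
      Metric.isOpen_iff.1 φ.open_target (φ x) (φ.map_source (mem_chart_source _ x))
    have hsrc : ball (φ x) r ⊆ φ.symm.source := by rwa [φ.symm_source]
    refine ⟨φ.symm '' ball (φ x) r, φ.symm.isOpen_image_of_subset_source isOpen_ball hsrc,
      ⟨φ x, mem_ball_self hr, φ.left_inv (mem_chart_source _ x)⟩, ?_⟩
    -- the chart ball of the half-space is convex, hence contractible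
    haveI : ContractibleSpace ↥(ball (φ x) r) := by
      have hconv : Convex ℝ ((Subtype.val : EuclideanHalfSpace (n + 1) → _) '' ball (φ x) r) := by
        have heq : (Subtype.val : EuclideanHalfSpace (n + 1) → _) '' ball (φ x) r =
            {y : EuclideanSpace ℝ (Fin (n + 1)) | 0 ≤ y 0} ∩ ball (φ x).1 r := by
          ext y
          constructor
          · rintro ⟨z, hz, rfl⟩
            exact ⟨z.2, hz⟩
          · rintro ⟨hy, hyb⟩
            exact ⟨⟨y, hy⟩, hyb, rfl⟩
        rw [heq]
        exact EuclideanHalfSpace.convex.inter (convex_ball _ _)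
      haveI : ContractibleSpace ↥((Subtype.val : EuclideanHalfSpace (n + 1) → _) '' ball (φ x) r) :=
        hconv.contractibleSpace ⟨(φ x).1, ⟨φ x, mem_ball_self hr, rfl⟩⟩
      have hemb : Topology.IsEmbedding
          (fun z : ↥(ball (φ x) r) => ((z.1.1 : EuclideanSpace ℝ (Fin (n + 1))))) :=
        Topology.IsEmbedding.subtypeVal.comp Topology.IsEmbedding.subtypeVal
      have hrange : range (fun z : ↥(ball (φ x) r) => (z.1.1 : EuclideanSpace ℝ (Fin (n + 1)))) =
          (Subtype.val : EuclideanHalfSpace (n + 1) → _) '' ball (φ x) r := by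
        ext y
        constructor
        · rintro ⟨z, rfl⟩
          exact ⟨z.1, z.2, rfl⟩
        · rintro ⟨w, hw, rfl⟩
          exact ⟨⟨w, hw⟩, rfl⟩
      have e : ↥(ball (φ x) r) ≃ₜ
          ↥((Subtype.val : EuclideanHalfSpace (n + 1) → _) '' ball (φ x) r) :=
        hemb.toHomeomorph.trans (Homeomorph.setCongr hrange)
      exact e.contractibleSpace
    have e : ↥(ball (φ x) r) ≃ₜ ↥(φ.symm '' ball (φ x) r) :=
      φ.symm.homeomorphOfImageSubsetSource hsrc rfl
    exact e.toHomotopyEquiv.simplyConnectedSpace_iff.1 inferInstance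
  choose W hWo hxW hWsc using hW
  -- ### a Lebesgue number `δ` of the cover by chart balls
  obtain ⟨δ, hδ, hleb⟩ := lebesgue_number_lemma_of_metric isCompact_univ hWo
    (fun y _ => mem_iUnion.2 ⟨y, hxW y⟩)
  -- ### small path-connected open neighbourhoods
  set U : V → Set V := fun y => pathComponentIn (ball y (δ / 2)) y with hUdef
  have hUo : ∀ y, IsOpen (U y) := fun y => isOpen_ball.pathComponentIn y
  have hyU : ∀ y, y ∈ U y := fun y => mem_pathComponentIn_self (mem_ball_self (by positivity))
  have hUpc : ∀ y, IsPathConnected (U y) := fun y =>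
    isPathConnected_pathComponentIn (mem_ball_self (by positivity))
  have hUball : ∀ y, U y ⊆ ball y (δ / 2) := fun y => pathComponentIn_subset
  -- ### a finite subcover
  obtain ⟨t, ht⟩ := isCompact_univ.elim_finite_subcover U hUo (fun y _ => mem_iUnion.2 ⟨y, hyU y⟩)
  refine fundamentalGroup_fg_of_finite_cover (ι := ↥t) (fun k => U k) (fun k => hUo k)
    (fun k => hUpc k) ?_ ?_ x₀
  · refine eq_univ_of_univ_subset fun y hy => ?_
    obtain ⟨k, hk⟩ := mem_iUnion.1 (ht hy)
    obtain ⟨hkt, hyk⟩ := mem_iUnion.1 hk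
    exact mem_iUnion.2 ⟨⟨k, hkt⟩, hyk⟩
  · rintro j k ⟨z, hzj, hzk⟩ y γ hγ
    obtain ⟨x, hx⟩ := hleb z (mem_univ z)
    refine homotopic_refl_of_range_subset (hWsc x) γ (hγ.trans ((union_subset ?_ ?_).trans hx))
    · intro w hw
      rw [mem_ball]
      have h1 := mem_ball.1 (hUball _ hw)
      have h2 := mem_ball.1 (hUball _ hzj)
      calc dist w z ≤ dist w (j : V) + dist (j : V) z := dist_triangle _ _ _
        _ < δ / 2 + δ / 2 := add_lt_add h1 (by rwa [dist_comm])
        _ = δ := by ring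
    · intro w hw
      rw [mem_ball]
      have h1 := mem_ball.1 (hUball _ hw)
      have h2 := mem_ball.1 (hUball _ hzk)
      calc dist w z ≤ dist w (k : V) + dist (k : V) z := dist_triangle _ _ _
        _ < δ / 2 + δ / 2 := add_lt_add h1 (by rwa [dist_comm])
        _ = δ := by ring

/-- **`π₁` of a null-cobordism is finitely generated** (a compact manifold with boundary).
[cite: HatcherAT2002, Lemma 1.15 and proof of Thm. 1.20] -/
theorem NullCobordism.fg_fundamentalGroup {n : ℕ} {M : Type} [TopologicalSpace M]
    [ChartedSpace (EuclideanSpace ℝ (Fin n)) M] (c : NullCobordism n M) (x₀ : c.W) :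
    Group.FG (_root_.FundamentalGroup c.W x₀) :=
  fundamentalGroup_fg_of_compactSpace_chartedSpace_halfSpace (n := n) x₀


/-! ### Small bookkeeping lemmas on fundamental groups -/

section Bookkeeping

variable {A : Type*} [TopologicalSpace A]

/-- The class of a loop is trivial iff the loop is null-homotopic rel end points. [folklore] -/
private theorem fromPath_mk_eq_one_iff_homotopic {x : A} (γ : Path x x) :
    _root_.FundamentalGroup.fromPath (Path.Homotopic.Quotient.mk γ) = 1 ↔
      γ.Homotopic (Path.refl x) := by
  rw [_root_.FundamentalGroup.one_def]
  exact Quotient.eq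

/-- Bijectivity of `i_* : π₁(S, x) → π₁(Y, x)` transported along equalities of the set and of
the base point. [folklore] -/
private theorem bijective_inclHom_congr_set {Y : Type*} [TopologicalSpace Y] {S S' : Set Y}
    (hS : S = S') {x x' : Y} (hx : x = x') (h : x ∈ S) (h' : x' ∈ S') :
    Bijective (inclHom S x h) ↔ Bijective (inclHom S' x' h') := by
  subst hS; subst hx; rfl

/-- Conjugate loops (`LoopConj`) recorded at pointwise equal loops. [folklore] -/
private theorem loopConj_of_forall_eq {Y : Type*} [TopologicalSpace Y] {x₀ x₁ x₂ : Y}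
    {β₀ : Path x₀ x₀} {β₁ : Path x₁ x₁} {β₂ : Path x₂ x₂} (h : LoopConj β₀ β₁)
    (e : ∀ t, β₁ t = β₂ t) : LoopConj β₀ β₂ := by
  obtain rfl : x₁ = x₂ := by rw [← β₁.source, ← β₂.source]; exact e 0
  exact h.trans (LoopConj.of_eq e)

/-- **Images of all generators but one killed generator still generate**: for an epimorphism
`Φ : G ↠ H`, a finite generating set `G₀ ∋ g₀` of `G` with `Φ g₀ = 1`, the set `Φ(G₀ ∖ {g₀})`
generates `H`. [folklore] -/
theorem closure_image_erase_eq_top {G H : Type*} [Group G] [Group H] [DecidableEq G]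
    [DecidableEq H] (Φ : G →* H) (hΦ : Surjective Φ) {G₀ : Finset G}
    (hG₀ : Subgroup.closure (G₀ : Set G) = ⊤) {g₀ : G} (hg₀ : g₀ ∈ G₀) (h0 : Φ g₀ = 1) :
    Subgroup.closure ((G₀.erase g₀).image Φ : Set H) = ⊤ := by
  rw [Finset.coe_image, ← MonoidHom.map_closure]
  have hG' : Subgroup.closure (insert g₀ ((G₀.erase g₀ : Finset G) : Set G)) = ⊤ := by
    rw [Finset.coe_erase, Set.insert_sdiff_singleton, insert_eq_of_mem (Finset.mem_coe.2 hg₀), hG₀]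
  rw [insert_eq, Subgroup.closure_union] at hG'
  have hmap := congrArg (Subgroup.map Φ) hG'
  rw [Subgroup.map_sup, MonoidHom.map_closure, image_singleton, h0,
    Subgroup.closure_singleton_one, bot_sup_eq, ← MonoidHom.range_eq_map,
    MonoidHom.range_eq_top.2 hΦ] at hmap
  exact hmap

end Bookkeeping

namespace FramedSphereFamily

/-! ### Path-connectedness of the complement and of the surgered space -/

section General

variable {EX HX : Type*} [NormedAddCommGroup EX] [NormedSpace ℝ EX] [TopologicalSpace HX]
  {IX : ModelWithCorners ℝ EX HX} {X : Type} [TopologicalSpace X] [ChartedSpace HX X] [T2Space X]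
  {ι : Type} [Unique ι] {k l : ℕ} (ν : FramedSphereFamily IX X ι k (l + 1))
  {P : Type} [TopologicalSpace P] {jA : ↥ν.complement → P} {jB : ↥(ballTimesSphere ι k l) → P}

/-- **Removing a framed sphere with normal fibre `ℝˡ⁺¹`, `l ≥ 2`, keeps a path-connected
manifold path connected** (`k ≥ 1`; rerouting paths through the punctured tube,
`VanKampen.isPathConnected_compl_of_nbhd`). [cite: Kosinski1993, Ch. X §2, Thm. 2.2 (proof)] -/
theorem pathConnectedSpace_complement_of_pathConnectedSpace [PathConnectedSpace X] (hk : 1 ≤ k)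
    (hl : 2 ≤ l) : PathConnectedSpace ↥ν.complement := by
  haveI := Literature.AlgebraicTopology.SingularHomology.pathConnectedSpace_sphere (n := k)
    (by omega)
  haveI := simplyConnectedSpace_compl_zero hl
  have hφ := ν.isOpenEmbedding_toFun default
  have hUpc : IsPathConnected
      (ν.toFun default '' (univ ×ˢ ({0} : Set (EuclideanSpace ℝ (Fin (l + 1))))))ᶜ := by
    have hUT := (image_compl_zero_eq
      (Z := (Metric.sphere (0 : EuclideanSpace ℝ (Fin (k + 1))) 1))
      (E := EuclideanSpace ℝ (Fin (l + 1))) hφ.injective).symm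
    refine isPathConnected_compl_of_nbhd (isClosed_image_core hφ.continuous) hφ.isOpen_range
      (image_subset_range _ _) isPathConnected_univ ?_
    rw [sdiff_eq, inter_comm, hUT]
    refine IsPathConnected.image ?_ hφ.continuous
    have : {q : (Metric.sphere (0 : EuclideanSpace ℝ (Fin (k + 1))) 1) ×
        EuclideanSpace ℝ (Fin (l + 1)) | q.2 ∈ (({0} : Set (EuclideanSpace ℝ (Fin (l + 1))))ᶜ)} =
        univ ×ˢ ({0}ᶜ : Set (EuclideanSpace ℝ (Fin (l + 1)))) := by
      ext q; simp
    rw [this]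
    exact isPathConnected_univ.prod (isPathConnected_iff_pathConnectedSpace.2 inferInstance)
  rw [← coe_complement_eq] at hUpc
  exact isPathConnected_iff_pathConnectedSpace.1 hUpc

include ν in
variable {ν} in
/-- **The surgered space is path connected** when `X` is (`k ≥ 1`, `l ≥ 2`): it is the union of
the images of the path-connected pieces `X ∖ S` and `OD^{k+1} × Sˡ`, which meet.
[cite: Kosinski1993, Ch. X §2, Thm. 2.2 (proof)] -/
theorem pathConnectedSpace_of_surgery [PathConnectedSpace X] (hA : IsOpenEmbedding jA)
    (hB : IsOpenEmbedding jB) (hcov : range jA ∪ range jB = univ)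
    (hrel : ∀ a b, jA a = jB b ↔ sphereFamilySurgeryRel ν a b) (hk : 1 ≤ k) (hl : 2 ≤ l) :
    PathConnectedSpace P := by
  haveI := ν.pathConnectedSpace_complement_of_pathConnectedSpace hk hl
  haveI := simplyConnectedSpace_ballTimesSphere ι k hl
  have hU : IsPathConnected (range jA) := isPathConnected_range hA.continuous
  have hT : IsPathConnected (range jB) := isPathConnected_range hB.continuous
  obtain ⟨a₀, ha₀⟩ := exists_mem_gluedPart (ν := ν)
  have h := hU.union hT ⟨jA a₀, mem_range_self a₀, apply_mem_range_jB hrel ha₀⟩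
  rw [hcov] at h
  exact pathConnectedSpace_iff_univ.2 h

include ν in
variable {ν} in
/-- **In `P` the parallel sphere is a sphere of the handle**: `jA ∘ (u ↦ φ(u, v₀))` factors as
`jB ∘ b` with `b u = (‖v₀‖ u, v₀/‖v₀‖) ∈ OD^{k+1} × Sˡ` (`0 < ‖v₀‖ < 1`).
[cite: Kosinski1993, Ch. X §1, Prop. 1.1] -/
theorem exists_comp_parallelSphere_eq (hrel : ∀ a b, jA a = jB b ↔ sphereFamilySurgeryRel ν a b)
    (hBc : Continuous jB) (hAc : Continuous jA) {v₀ : EuclideanSpace ℝ (Fin (l + 1))}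
    (hv₀ : v₀ ≠ 0) (hv₁ : ‖v₀‖ < 1) :
    ∃ b : C((Metric.sphere (0 : EuclideanSpace ℝ (Fin (k + 1))) 1), ↥(ballTimesSphere ι k l)),
      (⟨jA, hAc⟩ : C(_, P)).comp (ν.parallelSphere hv₀) = (⟨jB, hBc⟩ : C(_, P)).comp b := by
  let b : C((Metric.sphere (0 : EuclideanSpace ℝ (Fin (k + 1))) 1), ↥(ballTimesSphere ι k l)) :=
    { toFun := fun u ↦ ⟨(DiscreteIndex.mk default,
        (‖v₀‖ • (u : EuclideanSpace ℝ (Fin (k + 1))), radialProjection (spherePt l) v₀)), by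
          rw [mem_ballTimesSphere_iff, norm_smul_coe_sphere (norm_nonneg _)]; exact hv₁⟩
      continuous_toFun := by
        have h1 : Continuous fun u : (Metric.sphere (0 : EuclideanSpace ℝ (Fin (k + 1))) 1) ↦
            ‖v₀‖ • (u : EuclideanSpace ℝ (Fin (k + 1))) := by fun_prop
        have h2 : Continuous fun u : (Metric.sphere (0 : EuclideanSpace ℝ (Fin (k + 1))) 1) ↦
            (DiscreteIndex.mk (default : ι),
              (‖v₀‖ • (u : EuclideanSpace ℝ (Fin (k + 1))), radialProjection (spherePt l) v₀)) :=
          Continuous.prodMk continuous_const (Continuous.prodMk h1 continuous_const)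
        exact h2.subtype_mk _ }
  refine ⟨b, ?_⟩
  ext u
  show jA (ν.parallelSphere hv₀ u) = jB (b u)
  refine (hrel _ _).2 ⟨u, ‖v₀‖, ⟨norm_pos_iff.2 hv₀, hv₁⟩, rfl, ?_⟩
  show ν.toFun default (u, v₀) = ν.toFun (DiscreteIndex.mk.symm (DiscreteIndex.mk default))
    (u, ‖v₀‖ • (radialProjection (spherePt l) v₀ : EuclideanSpace ℝ (Fin (l + 1))))
  rw [norm_smul_coe_radialProjection]
  rfl

end General

/-! ### Lemma 5.2 for `p = 1`: an epimorphism `π₁(X) ↠ π₁(χ(X, φ))` killing the core circle -/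

section Circle

variable {EX HX : Type*} [NormedAddCommGroup EX] [NormedSpace ℝ EX] [TopologicalSpace HX]
  {IX : ModelWithCorners ℝ EX HX} {X : Type} [TopologicalSpace X] [ChartedSpace HX X] [T2Space X]
  {ι : Type} [Unique ι] {l : ℕ} {ν : FramedSphereFamily IX X ι 1 (l + 1)}
  {P : Type} [TopologicalSpace P] {jA : ↥ν.complement → P} {jB : ↥(ballTimesSphere ι 1 l) → P}
  (hA : IsOpenEmbedding jA) (hB : IsOpenEmbedding jB) (hcov : range jA ∪ range jB = univ)
  (hrel : ∀ a b, jA a = jB b ↔ sphereFamilySurgeryRel ν a b)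

include hA hB hcov hrel in
/-- **Kervaire–Milnor's Lemma 5.2 for `p = 1`** (van Kampen form).  Let `φ : S¹ × ℝˡ⁺¹ ↪ X`
(`l ≥ 2`) be a framed circle in a path-connected `X`, with core circle `c(u) = φ(u, 0)`, and let
`P = jA(X ∖ S) ∪ jB(OD² × Sˡ)` be the surgered space.  Then for every base point `x₀` there is an
EPIMORPHISM `Φ : π₁(X, x₀) ↠ π₁(P, p₀)` whose kernel contains the class of every loop `γ` at `x₀`
freely homotopic to the core circle (`LoopConj γ ℓ(c)`): `Φ` is the composite of the change of
base point to `a₀ = φ(u₀, v₀)`, the inverse of the isomorphism `π₁(X ∖ S, a₀) ≅ π₁(X, a₀)`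
(`VanKampen.bijective_inclHom_compl_core`: the normal fibre `ℝˡ⁺¹` has simply connected
puncture) and `jA_* : π₁(X ∖ S, a₀) ↠ π₁(P, jA a₀)` (`surjective_inclHom_range_jA`: the handle
`OD² × Sˡ` is simply connected); a loop freely homotopic to the core is freely homotopic to the
parallel circle `u ↦ φ(u, v₀)`, i.e. conjugate to it in `π₁`, and the parallel circle is in `P`
the circle `{‖y‖ = ‖v₀‖} × pt` of the handle, null-homotopic there — "the effect of the
modification `χ(φ)` is to kill the homotopy class `λ`" (Kervaire–Milnor 1963, p. 513).
[cite: KervaireMilnorAnnals1963, Lemma 5.2 (p. 513)] -/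
theorem exists_surjective_fundamentalGroup_of_surgery_one [PathConnectedSpace X] (hl : 2 ≤ l)
    (x₀ : X) :
    ∃ (p₀ : P) (Φ : _root_.FundamentalGroup X x₀ →* _root_.FundamentalGroup P p₀),
      Surjective Φ ∧
        ∀ γ : Path x₀ x₀, LoopConj γ ν.sphereMap.circleLoop →
          Φ (_root_.FundamentalGroup.fromPath (Path.Homotopic.Quotient.mk γ)) = 1 := by
  classical
  haveI := ν.pathConnectedSpace_complement_of_pathConnectedSpace le_rfl hl
  haveI := simplyConnectedSpace_ballTimesSphere ι 1 hl
  -- ### the base point `a₀ = φ(u₀, v₀)` on the parallel circle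
  let v₀ : EuclideanSpace ℝ (Fin (l + 1)) := (2⁻¹ : ℝ) • EuclideanSpace.single 0 1
  have hv₀ : v₀ ≠ 0 := by
    intro h
    have : ‖v₀‖ = 2⁻¹ := by simp [v₀, norm_smul]
    rw [h, norm_zero] at this
    norm_num at this
  have hv₁ : ‖v₀‖ < 1 := by simp [v₀, norm_smul]; norm_num
  set par := ν.parallelSphere hv₀ with hpar_def
  set a₀ : ↥ν.complement := par (circlePoint 0) with ha₀_def
  have ha₀ : a₀ ∈ ν.gluedPart := ⟨(circlePoint 0, v₀), ⟨hv₀, hv₁⟩, rfl⟩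
  -- ### (1) `Φ₀ = jA_* : π₁(X ∖ S, a₀) ↠ π₁(P, jA a₀)`
  let e : ↥ν.complement ≃ₜ ↥(range jA) := hA.isEmbedding.toHomeomorph
  have he : e a₀ = ⟨jA a₀, mem_range_self a₀⟩ := rfl
  let Φ₀ : _root_.FundamentalGroup (↥ν.complement) a₀ →* _root_.FundamentalGroup P (jA a₀) :=
    (inclHom (range jA) (jA a₀) (mem_range_self a₀)).comp
      (fundamentalGroupEquivOfHomeomorph e he).toMonoidHom
  have hΦ₀ : Surjective Φ₀ :=
    (surjective_inclHom_range_jA hA hB hcov hrel le_rfl hl ha₀).comp (MulEquiv.surjective _)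
  have hΦ₀_apply : ∀ γ : Path a₀ a₀,
      Φ₀ (_root_.FundamentalGroup.fromPath (Path.Homotopic.Quotient.mk γ)) =
        _root_.FundamentalGroup.fromPath (Path.Homotopic.Quotient.mk (γ.map hA.continuous)) := by
    intro γ
    show inclHom (range jA) (jA a₀) (mem_range_self a₀)
      (_root_.FundamentalGroup.mapOfEq (e : C(↥ν.complement, ↥(range jA))) he
        (_root_.FundamentalGroup.fromPath (Path.Homotopic.Quotient.mk γ))) = _
    rw [inclHom, FundamentalGroup.mapOfEq_fromPath_eq (e : C(↥ν.complement, ↥(range jA))) he γ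
      ((γ.map e.continuous).cast he.symm he.symm) fun _ => rfl]
    exact FundamentalGroup.mapOfEq_fromPath_eq _ rfl _ _ fun _ => rfl
  -- ### (2) the parallel circle dies in `P`
  have hkill₀ : Φ₀ (_root_.FundamentalGroup.fromPath
      (Path.Homotopic.Quotient.mk par.circleLoop)) = 1 := by
    rw [hΦ₀_apply, fromPath_mk_eq_one_iff_homotopic]
    obtain ⟨b, hb⟩ := exists_comp_parallelSphere_eq hrel hB.continuous hA.continuous hv₀ hv₁
    change ((⟨jA, hA.continuous⟩ : C(_, P)).comp par).circleLoop.Homotopic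
      (Path.refl (((⟨jA, hA.continuous⟩ : C(_, P)).comp par) (circlePoint 0)))
    rw [hb, ContinuousMap.circleLoop_comp]
    have h0 : b.circleLoop.Homotopic (Path.refl _) := SimplyConnectedSpace.paths_homotopic _ _
    have h1 := h0.map (⟨jB, hB.continuous⟩ : C(_, P))
    have h2 : (Path.refl (b (circlePoint 0))).map (⟨jB, hB.continuous⟩ : C(_, P)).continuous =
        Path.refl _ := by
      ext t
      rfl
    rw [h2] at h1
    exact h1
  -- ### (3) `ι_* : π₁(X ∖ S, a₀) ≅ π₁(X, a₀)`
  have hbij : Bijective (inclHom (ν.complement : Set X) (a₀ : X) a₀.2) := by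
    haveI := Literature.AlgebraicTopology.SingularHomology.pathConnectedSpace_sphere (n := 1)
      one_ne_zero
    haveI := simplyConnectedSpace_compl_zero hl
    have hb := bijective_inclHom_compl_core
      (Z := (Metric.sphere (0 : EuclideanSpace ℝ (Fin (1 + 1))) 1))
      (E := EuclideanSpace ℝ (Fin (l + 1))) (W := X) (φ := ν.toFun default)
      (ν.isOpenEmbedding_toFun default) (q₀ := (circlePoint 0, v₀)) hv₀
    exact (bijective_inclHom_congr_set (coe_complement_eq ν).symm rfl _ a₀.2).1 hb
  let ιe : _root_.FundamentalGroup (↥ν.complement) a₀ ≃* _root_.FundamentalGroup X (a₀ : X) :=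
    MulEquiv.ofBijective _ hbij
  have hιe_apply : ∀ γ : Path a₀ a₀,
      ιe (_root_.FundamentalGroup.fromPath (Path.Homotopic.Quotient.mk γ)) =
        _root_.FundamentalGroup.fromPath
          (Path.Homotopic.Quotient.mk (γ.map continuous_subtype_val)) := fun γ ↦
    inclHom_fromPath a₀.2 γ
  -- ### (4) the epimorphism `Φ = Φ₀ ∘ ι_*⁻¹ ∘ β_δ`
  let δ : Path x₀ (a₀ : X) := PathConnectedSpace.somePath x₀ (a₀ : X)
  let β := _root_.FundamentalGroup.fundamentalGroupMulEquivOfPath δ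
  refine ⟨jA a₀, Φ₀.comp (ιe.symm.toMonoidHom.comp β.toMonoidHom),
    hΦ₀.comp (ιe.symm.surjective.comp β.surjective), fun γ hγ ↦ ?_⟩
  -- ### (5) a loop freely homotopic to the core dies
  -- the loop `δ⁻¹ γ δ` at `a₀` is conjugate to the parallel circle
  set L₁ : Path (a₀ : X) (a₀ : X) := δ.symm.trans (γ.trans δ) with hL₁
  set parX : Path (a₀ : X) (a₀ : X) := par.circleLoop.map continuous_subtype_val with hparX
  have hcore : LoopConj ν.sphereMap.circleLoop parX := by
    refine LoopConj.of_square
      ⟨fun p ↦ ν.toFun default (circleParam p.2, (p.1 : ℝ) • v₀), ?_⟩ (fun s ↦ ?_)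
      ν.sphereMap.circleLoop parX (fun t ↦ ?_) (fun t ↦ ?_)
    · exact (ν.continuous default).comp ((circleParam.continuous.comp continuous_snd).prodMk
        ((continuous_subtype_val.comp continuous_fst).smul continuous_const))
    · simp only [ContinuousMap.coe_mk, circleParam_zero, circleParam_one]
    · change ν.toFun default (circleParam t, 0) =
        ν.toFun default (circleParam t, ((0 : unitInterval) : ℝ) • v₀)
      rw [show ((0 : unitInterval) : ℝ) = 0 from rfl, zero_smul]
    · change ν.toFun default (circleParam t, v₀) =
        ν.toFun default (circleParam t, ((1 : unitInterval) : ℝ) • v₀)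
      rw [show ((1 : unitInterval) : ℝ) = 1 from rfl, one_smul]
  have hL₁ : LoopConj γ L₁ := ⟨δ, rfl⟩
  obtain ⟨m, hm⟩ : LoopConj parX L₁ := hcore.symm.trans (hγ.symm.trans hL₁)
  -- in the group: `[L₁] = c [parX] c⁻¹`, `c = [m]`
  set c : _root_.FundamentalGroup X (a₀ : X) :=
    _root_.FundamentalGroup.fromPath (Path.Homotopic.Quotient.mk m) with hc
  have hgrp : β (_root_.FundamentalGroup.fromPath (Path.Homotopic.Quotient.mk γ)) =
      c * _root_.FundamentalGroup.fromPath (Path.Homotopic.Quotient.mk parX) * c⁻¹ := by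
    show _root_.FundamentalGroup.fromPath (Path.Homotopic.Quotient.mk L₁) = _
    change _root_.FundamentalGroup.fromPath (Path.Homotopic.Quotient.mk L₁) =
      _root_.FundamentalGroup.fromPath (Path.Homotopic.Quotient.mk (m.symm.trans (parX.trans m)))
    exact congrArg _ hm
  -- lift to `X ∖ S`
  obtain ⟨c', hc'⟩ := ιe.surjective c
  have hparX : _root_.FundamentalGroup.fromPath (Path.Homotopic.Quotient.mk parX) =
      ιe (_root_.FundamentalGroup.fromPath (Path.Homotopic.Quotient.mk par.circleLoop)) := by
    rw [hιe_apply]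
  have hlift : ιe.symm (β (_root_.FundamentalGroup.fromPath (Path.Homotopic.Quotient.mk γ))) =
      c' * _root_.FundamentalGroup.fromPath (Path.Homotopic.Quotient.mk par.circleLoop) * c'⁻¹ := by
    apply ιe.injective
    rw [MulEquiv.apply_symm_apply, hgrp, map_mul, map_mul, map_inv, hc', hparX]
  show Φ₀ (ιe.symm (β (_root_.FundamentalGroup.fromPath (Path.Homotopic.Quotient.mk γ)))) = 1
  rw [hlift, map_mul, map_mul, map_inv, hkill₀, mul_one, mul_inv_cancel]

end Circle

/-! ### One circle surgery kills one generator of `π₁` -/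

section SurgeredGeneral

variable {n k l : ℕ} {X : Type} [TopologicalSpace X] [ChartedSpace (EuclideanHalfSpace (n + 1)) X]
  [T2Space X] [IsManifold (𝓡∂ (n + 1)) ∞ X] {ι : Type} [Unique ι]
  (ν : FramedSphereFamily (𝓡∂ (n + 1)) X ι k (l + 1)) (hkl : k + l = n)

/-- **The surgered manifold `χ(X, φ)` is path connected** when `X` is (`k ≥ 1`, `l ≥ 2`).
[cite: Kosinski1993, Ch. X §2, Thm. 2.2 (proof)] -/
theorem pathConnectedSpace_surgered [PathConnectedSpace X] (hk : 1 ≤ k) (hl : 2 ≤ l) :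
    PathConnectedSpace (ν.Surgered hkl) := by
  obtain ⟨hA, hB, hcov, hrel⟩ := ν.surgered_gluing hkl
  exact pathConnectedSpace_of_surgery hA hB hcov hrel hk hl

end SurgeredGeneral

section Surgered

variable {n l : ℕ} {X : Type} [TopologicalSpace X] [ChartedSpace (EuclideanHalfSpace (n + 1)) X]
  [T2Space X] [IsManifold (𝓡∂ (n + 1)) ∞ X] {ι : Type} [Unique ι]
  (ν : FramedSphereFamily (𝓡∂ (n + 1)) X ι 1 (l + 1)) (hkl : 1 + l = n)

/-- **One circle surgery kills one generator of `π₁`** (Kervaire–Milnor 1963, proof of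
Thm. 5.5, p. 514: "`π₁M'` is generated by fewer elements than `π₁M`").  If `π₁(X, x₀)` is
generated by a finite set `G` containing the class `g₀` of a loop `γ₀` freely homotopic to the
core circle of the framed circle `ν` (`l ≥ 2`), then `π₁(χ(X, ν), p₀)` is generated by a finite
set with at most `#G - 1` elements (the images of `G ∖ {g₀}` under the epimorphism of
`exists_surjective_fundamentalGroup_of_surgery_one`).
[cite: KervaireMilnorAnnals1963, Thm. 5.5 (proof, p. 514)] -/
theorem exists_generators_fundamentalGroup_surgered_one [PathConnectedSpace X] (hl : 2 ≤ l)
    {x₀ : X} {G : Finset (_root_.FundamentalGroup X x₀)}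
    (hG : Subgroup.closure (G : Set (_root_.FundamentalGroup X x₀)) = ⊤)
    {g₀ : _root_.FundamentalGroup X x₀} (hg₀ : g₀ ∈ G) {γ₀ : Path x₀ x₀}
    (hγ₀ : _root_.FundamentalGroup.fromPath (Path.Homotopic.Quotient.mk γ₀) = g₀)
    (hconj : LoopConj γ₀ ν.sphereMap.circleLoop) :
    ∃ (p₀ : ν.Surgered hkl) (G' : Finset (_root_.FundamentalGroup (ν.Surgered hkl) p₀)),
      G'.card + 1 ≤ G.card ∧
        Subgroup.closure (G' : Set (_root_.FundamentalGroup (ν.Surgered hkl) p₀)) = ⊤ := by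
  classical
  obtain ⟨hA, hB, hcov, hrel⟩ := ν.surgered_gluing hkl
  obtain ⟨p₀, Φ, hΦ, hkill⟩ :=
    exists_surjective_fundamentalGroup_of_surgery_one hA hB hcov hrel hl x₀
  have h0 : Φ g₀ = 1 := by rw [← hγ₀]; exact hkill γ₀ hconj
  refine ⟨p₀, (G.erase g₀).image Φ, ?_, closure_image_erase_eq_top Φ hΦ hG hg₀ h0⟩
  calc ((G.erase g₀).image Φ).card + 1 ≤ (G.erase g₀).card + 1 := by
        gcongr; exact Finset.card_image_le
    _ = G.card := by
        rw [Finset.card_erase_of_mem hg₀]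
        exact Nat.sub_add_cancel (Finset.card_pos.2 ⟨g₀, hg₀⟩)

/-- The same, with the representation hypothesis in the form produced by Whitney's embedding
theorem: the core circle of `ν` is HOMOTOPIC AS A MAP OF `S¹` to the circle map of `γ₀`
(`ContinuousMap.homotopic_iff_loopConj`). [cite: KervaireMilnorAnnals1963, Thm. 5.5 (proof, p. 514)] -/
theorem exists_generators_fundamentalGroup_surgered_one_of_homotopic [PathConnectedSpace X]
    (hl : 2 ≤ l) {x₀ : X} {G : Finset (_root_.FundamentalGroup X x₀)}
    (hG : Subgroup.closure (G : Set (_root_.FundamentalGroup X x₀)) = ⊤)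
    {g₀ : _root_.FundamentalGroup X x₀} (hg₀ : g₀ ∈ G) {γ₀ : Path x₀ x₀}
    (hγ₀ : _root_.FundamentalGroup.fromPath (Path.Homotopic.Quotient.mk γ₀) = g₀)
    (hhom : ν.sphereMap.Homotopic (pathCircleMap γ₀)) :
    ∃ (p₀ : ν.Surgered hkl) (G' : Finset (_root_.FundamentalGroup (ν.Surgered hkl) p₀)),
      G'.card + 1 ≤ G.card ∧
        Subgroup.closure (G' : Set (_root_.FundamentalGroup (ν.Surgered hkl) p₀)) = ⊤ := by
  refine ν.exists_generators_fundamentalGroup_surgered_one hkl hl hG hg₀ hγ₀ ?_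
  have h := (ContinuousMap.homotopic_iff_loopConj _ _).1 hhom
  exact (loopConj_of_forall_eq h fun t ↦ by
    rw [ContinuousMap.circleLoop_apply, pathCircleMap_circleParam]).symm

end Surgered

end FramedSphereFamily

/-! ### Theorem 5.5, first step: killing `π₁` by circle surgeries -/

namespace NullCobordism

variable {n : ℕ} {M : Type} [TopologicalSpace M] [ChartedSpace (EuclideanSpace ℝ (Fin n)) M]

/-- A connected null-cobordism is path connected (manifolds are locally path connected).
[folklore] -/
theorem pathConnectedSpace_of_connectedSpace (c : NullCobordism n M) [ConnectedSpace c.W] :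
    PathConnectedSpace c.W := by
  haveI := ChartedSpace.locallyPathConnectedSpace (EuclideanHalfSpace (n + 1)) c.W
  exact pathConnectedSpace_iff_connectedSpace.2 ‹_›

variable [IsManifold (𝓡 n) ∞ M]

/-- **Kervaire–Milnor's Thm. 5.5, first step, over the one-circle input.**  Let `M = ∂W` with
`dim W = n + 1 ≥ 4`, and let `Q` be a property of null-cobordisms of `M` such that (`h1`) for
every CONNECTED `W` with `Q W` and every map `f : S¹ → W` there is a framed circle
`ν : S¹ × ℝⁿ ↪ W` whose core circle is homotopic to `f` as a map of `S¹` and whose surgery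
`χ(W, ν)` (again a null-cobordism of `M`, `NullCobordism.surgery`) satisfies `Q`.  Then every
connected `W` with `Q W` may be replaced by a SIMPLY CONNECTED null-cobordism `W₁` of `M` with
`Q W₁`.  Proof (Kervaire–Milnor 1963, p. 514): `π₁(W)` is finitely generated
(`fundamentalGroup_fg_of_compactSpace_chartedSpace_halfSpace`); surgery on a framed circle
representing a generator leaves `W` connected with `π₁` generated by fewer elements
(`exists_generators_fundamentalGroup_surgered_one_of_homotopic`, Lemma 5.2); induct on the
number of generators.  With `Q W := IsStablyParallelizable (𝓡∂ (n + 1)) W`, `h1` is Lemmas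
5.3–5.4 at `p = 1` (Kosinski 1993, X.(2.1) at `k = 1`) and the conclusion is the hypothesis
`h55` / `h_simply` of `ThetaFourKervaireMilnorSurgeryProofs`, `SurgeryBelowMiddleDimension` and
`HCobordismThetaFiniteKMSurgery`. [cite: KervaireMilnorAnnals1963, Thm. 5.5 (proof, p. 514)] -/
theorem exists_simplyConnectedSpace_of_circleSurgery (hn : 3 ≤ n) (Q : NullCobordism n M → Prop)
    (h1 : ∀ c : NullCobordism n M, ConnectedSpace c.W → Q c →
      ∀ f : C(Metric.sphere (0 : EuclideanSpace ℝ (Fin 2)) 1, c.W),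
        ∃ (l : ℕ) (hkl : 1 + l = n) (ν : FramedSphereFamily (𝓡∂ (n + 1)) c.W Unit 1 (l + 1)),
          ν.sphereMap.Homotopic f ∧ Q (c.surgery ν hkl))
    (c : NullCobordism n M) [ConnectedSpace c.W] (hc : Q c) :
    ∃ c₁ : NullCobordism n M, SimplyConnectedSpace c₁.W ∧ Q c₁ := by
  classical
  -- induction on the number of generators of `π₁`
  suffices H : ∀ (r : ℕ) (c : NullCobordism n M), ConnectedSpace c.W → Q c →
      (∃ (x₀ : c.W) (G : Finset (_root_.FundamentalGroup c.W x₀)),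
        G.card ≤ r ∧ Subgroup.closure (G : Set (_root_.FundamentalGroup c.W x₀)) = ⊤) →
      ∃ c₁ : NullCobordism n M, SimplyConnectedSpace c₁.W ∧ Q c₁ by
    haveI := c.pathConnectedSpace_of_connectedSpace
    obtain ⟨x₀⟩ := (inferInstance : Nonempty c.W)
    obtain ⟨G, hG⟩ := Group.fg_def.1 (c.fg_fundamentalGroup x₀)
    exact H G.card c ‹_› hc ⟨x₀, G, le_rfl, hG⟩
  intro r
  induction r with
  | zero =>
    rintro c hcW hQ ⟨x₀, G, hG0, hG⟩
    have hGe : G = ∅ := Finset.card_eq_zero.1 (Nat.le_zero.1 hG0)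
    rw [hGe, Finset.coe_empty, Subgroup.closure_empty] at hG
    haveI := c.pathConnectedSpace_of_connectedSpace
    haveI : Subsingleton (_root_.FundamentalGroup c.W x₀) :=
      ⟨fun a b ↦ by
        have ha : a ∈ (⊥ : Subgroup (_root_.FundamentalGroup c.W x₀)) := hG ▸ Subgroup.mem_top a
        have hb : b ∈ (⊥ : Subgroup (_root_.FundamentalGroup c.W x₀)) := hG ▸ Subgroup.mem_top b
        rw [Subgroup.mem_bot] at ha hb
        rw [ha, hb]⟩
    exact ⟨c, simplyConnectedSpace_of_subsingleton x₀, hQ⟩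
  | succ r ih =>
    rintro c hcW hQ ⟨x₀, G, hGr, hG⟩
    by_cases hle : G.card ≤ r
    · exact ih c hcW hQ ⟨x₀, G, hle, hG⟩
    -- a generator `g₀` to kill, a representing loop `γ₀` and its circle map
    obtain ⟨g₀, hg₀⟩ : G.Nonempty := Finset.card_pos.1 (by omega)
    set γ₀ : Path x₀ x₀ := Quotient.out (_root_.FundamentalGroup.toPath g₀) with hγ₀def
    have hγ₀ : _root_.FundamentalGroup.fromPath (Path.Homotopic.Quotient.mk γ₀) = g₀ := by
      rw [hγ₀def]
      exact Quotient.out_eq _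
    -- the framed circle provided by `h1` and the surgery
    obtain ⟨l, hkl, ν, hhom, hQ'⟩ := h1 c hcW hQ (pathCircleMap γ₀)
    have hl : 2 ≤ l := by omega
    haveI := c.pathConnectedSpace_of_connectedSpace
    obtain ⟨p₀, G', hG'card, hG'⟩ :=
      ν.exists_generators_fundamentalGroup_surgered_one_of_homotopic hkl hl hG hg₀ hγ₀ hhom
    haveI : ConnectedSpace (c.surgery ν hkl).W := by
      haveI := ν.pathConnectedSpace_surgered hkl le_rfl hl
      show ConnectedSpace (ν.Surgered hkl)
      infer_instance
    exact ih (c.surgery ν hkl) this hQ' ⟨p₀, G', Nat.le_of_succ_le_succ (hG'card.trans hGr), hG'⟩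

end NullCobordism

end Literature.Topology.FourManifolds
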